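import Summits.NavierStokesRegularity.NavierStokesRegularity.Theses.AxisymmetricExtremality
import Literature.Analysis.FluidPDE.Seregin2020SwirlEnergyInequality
import HarnessLib

/-!
# Seregin 2020, Lemma 2.2 (after Nazarov–Uraltseva 2012): the slice identity of the energy
# method for the drift–heat operator `Δ - U·∇ - (2/ϱ)∂_ϱ` with a divergence-free drift, off the axis

Helper toward the stub `stub_seregin2020TypeII` of the crux `AxisymmetricKatoGlobal` (= the named
fact `Literature.Analysis.FluidPDE.Seregin2020_axisymmetricSingularPoint_typeII`, G. Seregin,
Anal. Math. Phys. 10 (2020) Paper 46 = arXiv:2006.04140, Thm 2.1). After this session's waves the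
fact is Lemma 2.2 of the paper — the propagation of a lower bound from the axis for nonnegative
SUPERsolutions of `∂ₜπ + (u + 2x'/|x'|²)·∇π - Δπ ≥ 0` in the class 𝒱 (the printed `≤ 0` of (2.12)
is a misprint, see the sibling `…Lemma22RenderedSign`) — plus a one-line assembly
(`blowupIndex_eq_top_of_weakHarnack`). The printed proof is Nazarov–Uraltseva, St. Petersburg
Math. J. 23 (2012), §3 and Lemma 4.2: every step (Lemma 3.1 Moser, Lemma 3.2 measure propagation,
Lemma 3.3 shrinking levels) starts from the ENERGY INEQUALITY obtained by testing the differential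
inequality with `φ'(V) ζ²` for a convex profile `φ` and a cut-off `ζ`, the drift being moved onto
the cut-off by `div b = 0` ((3.9): "Using (1.2), (1.3) [div b ≤ 0] and the Young inequality, we
obtain `∫(V-k)₋²ζ²|^{t} + ν∫∫|D(V-k)₋|²ζ² ≤ ∫(V-k)₋²ζ²|_{t₀} + ∫∫(C(V-k)₋²|Dζ|² + 2bᵢ(V-k)₋²ζDᵢζ)`").
This file is the fixed-time half of that computation in the tree's vocabulary for the class of
`hWH` (classical `C²` slices off the axis, the drift a pointwise `C¹` divergence-free
representative `U`, the singular drift `b = (2/ϱ)e_ϱ = 2x'/|x'|²`, smooth and divergence free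
off the axis by `Seregin2020.divergence_axisDrift_eq_zero`):

* `drift_energy_slice_identity` — for `F ∈ C²(O)`, `X ∈ C¹(O)` with `div X = 0` on an open `O`
  off the axis, `H ∈ C²` and `Θ ∈ C¹_c`, `tsupport Θ ⊆ O`:
  `∫ H'(F)(ΔF - DF[X] - (2/ϱ)∂_ϱF)Θ² = -∫(H''(F)|∇F|²Θ² + H'(F)⟪∇F,∇Θ²⟫) + ∫H(F)⟪X,∇Θ²⟫ + ∫(2/ϱ)H(F)∂_ϱ(Θ²)`
  (the tree's `Seregin2020.swirl_energy_slice_identity`, which is this identity for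
  `F = swirl (V s)`, `X = V s` inside the SZ2007 class, with the class replaced by its three
  used consequences; proof adapted from there);
* `continuousOn_drift_sliceFunctionals` — continuity in time of the slice functionals
  `M = ∫H(Φ)Θ²`, `G_H = ∫H''(Φ)|∇Φ|²Θ²`, `T₁ = ∫H'(Φ)⟪∇Φ,∇Θ²⟫`, `P = ∫H(Φ)|∇Θ|²`,
  `T_U = ∫H(Φ)⟪U,∇Θ²⟫`, `T_b = ∫(2/ϱ)H(Φ)∂_ϱΘ²` and of the time-derivative functional
  `D = ∫H'(Φ)(∂ₜΦ)Θ²`, for `Φ`, `U` with the joint continuity clauses of `hWH` on a slab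
  `]lo, hi[ × O`.

The time-integrated inequality for supersolutions is the sibling `…Lemma22EnergyInequality`.

## References

* G. Seregin, Anal. Math. Phys. 10 (2020), Paper 46 = arXiv:2006.04140, Lemma 2.2 and its proof
  sketch (arXiv p. 8). [Seregin2020]
* A. I. Nazarov, N. N. Uraltseva, St. Petersburg Math. J. 23 (2012) 93–115 = arXiv:1011.1888,
  §3, (3.2), (3.9), Remark 9, Lemma 4.2. [NazarovUraltseva2012]
-/

-- the problem directory repeats the summit name (D-0017); core's `dupNamespace` linter fires
set_option linter.dupNamespace false

noncomputable section

open MeasureTheory Set Function Filter Topology TopologicalSpace Metric WithLp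
open scoped NNReal ENNReal InnerProductSpace RealInnerProductSpace Laplacian

namespace Summit.NavierStokesRegularity.NavierStokesRegularity.Theorems.AxisymmetricKatoGlobal.EulerScaling

open Literature.Analysis.FluidPDE Literature.Analysis.FluidPDE.Seregin2020

/-! ### The slice identity -/

/-- **The slice identity of the energy method for `Δ - X·∇ - (2/ϱ)∂_ϱ` with `div X = 0`, off the
axis** (Nazarov–Uraltseva 2012, (3.2)/(3.9): the differential inequality tested with `φ'(V)ξ`,
the drift integrated by parts onto the cut-off using `div b = 0`; Seregin 2020, proof of
Lemma 2.2, "the proof of the lemma is based on the inequality …"). For an open `O` off the axis,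
`F ∈ C²(O)`, a field `X ∈ C¹(O)` with `div X = 0` on `O`, a profile `H ∈ C²` and a cut-off
`Θ ∈ C¹_c` with `tsupport Θ ⊆ O`:
`∫ H'(F)(ΔF - DF[X] - (2/ϱ)∂_ϱF)Θ² = -∫(H''(F)|∇F|²Θ² + H'(F)⟪∇F, ∇Θ²⟫) + ∫H(F)⟪X, ∇Θ²⟫ + ∫(2/ϱ)H(F)∂_ϱ(Θ²)`
(Green's identity; `div X = 0`; `div((2/ϱ)e_ϱ) = 0` off the axis). The tree's
`Seregin2020.swirl_energy_slice_identity` is the case `F = swirl (V s)`, `X = V s`.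
[cite: NazarovUraltseva2012, §3 (3.2) and (3.9), the integrations by parts] -/
theorem drift_energy_slice_identity : ∀ (O : Set (EuclideanSpace ℝ (Fin 3))), IsOpen O →
    (∀ x ∈ O, cylRadius x ≠ 0) → ∀ (F : EuclideanSpace ℝ (Fin 3) → ℝ), ContDiffOn ℝ 2 F O →
    ∀ (X : EuclideanSpace ℝ (Fin 3) → EuclideanSpace ℝ (Fin 3)), ContDiffOn ℝ 1 X O →
    (∀ x ∈ O, VectorCalculus.divergence X x = 0) →
    ∀ (H : ℝ → ℝ), ContDiff ℝ 2 H →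
    ∀ (Θ : EuclideanSpace ℝ (Fin 3) → ℝ), ContDiff ℝ 1 Θ → HasCompactSupport Θ → tsupport Θ ⊆ O →
    ∫ x, deriv H (F x) * ((Laplacian.laplacian F) x - fderiv ℝ F x (X x) -
        2 / cylRadius x * partialDeriv (eR x) F x) * Θ x ^ 2 =
      -(∫ x, (deriv (deriv H) (F x) * ‖gradient F x‖ ^ 2 * Θ x ^ 2 +
          deriv H (F x) * inner ℝ (gradient F x) (gradient (fun y => Θ y ^ 2) x))) +
      (∫ x, H (F x) * inner ℝ (X x) (gradient (fun y => Θ y ^ 2) x)) +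
      ∫ x, 2 / cylRadius x * (H (F x) * fderiv ℝ (fun y => Θ y ^ 2) x (eR x)) := by
  intro O hO hOρ F hF2 X hX1 hdivX H hH Θ hΘ hΘc hΘO
  -- adapted from `Literature.Analysis.FluidPDE.Seregin2020.swirl_energy_slice_identity`
  set K : Set (EuclideanSpace ℝ (Fin 3)) := tsupport Θ with hKdef
  have hK : IsCompact K := hΘc
  have hF1 : ContDiffOn ℝ 1 F O := hF2.of_le (by norm_cast)
  have hH1 : ContDiff ℝ 1 H := hH.of_le one_le_two
  have hH' : ContDiff ℝ 1 (deriv H) := by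
    have h2 : ContDiff ℝ (1 + 1) H := by rw [one_add_one_eq_two]; exact hH
    exact h2.deriv'
  -- continuity on `O` of the building blocks
  have cF : ContinuousOn F O := hF2.continuousOn
  have cHF : ContinuousOn (fun x => H (F x)) O := hH.continuous.comp_continuousOn cF
  have cH'F : ContinuousOn (fun x => deriv H (F x)) O := hH'.continuous.comp_continuousOn cF
  have cΔF : ContinuousOn (Δ F) O := continuousOn_laplacian_of_contDiffOn hO hF2
  have cgradF : ContinuousOn (gradient F) O := continuousOn_gradient_of_contDiffOn hO hF1
  have cfderivF : ContinuousOn (fderiv ℝ F) O := hF1.continuousOn_fderiv_of_isOpen hO le_rfl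
  have cX : ContinuousOn X O := hX1.continuousOn
  have ceR : ContinuousOn eR O := continuousOn_eR_offAxis.mono fun x hx => hOρ x hx
  have cinv : ContinuousOn (fun x => 2 / cylRadius x) O :=
    continuousOn_const.div continuous_cylRadius.continuousOn fun x hx => hOρ x hx
  have cΘ : Continuous Θ := hΘ.continuous
  have cΘ2 : Continuous fun y => Θ y ^ 2 := cΘ.pow 2
  have hΘ2 : ContDiff ℝ 1 fun y => Θ y ^ 2 := hΘ.pow 2
  have cgradΘ2 : Continuous (gradient fun y => Θ y ^ 2) := continuous_gradient_of_contDiff hΘ2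
  have cfderivΘ2 : Continuous (fderiv ℝ fun y => Θ y ^ 2) := hΘ2.continuous_fderiv one_ne_zero
  -- vanishing off `K`
  have hΘ0 : ∀ x, x ∉ K → Θ x = 0 := fun x hx => image_eq_zero_of_notMem_tsupport hx
  have hgΘ0 : ∀ x, x ∉ K → gradient (fun y => Θ y ^ 2) x = 0 := fun x hx => gradient_sq_eq_zero_of_notMem hx
  have hfΘ0 : ∀ x, x ∉ K → fderiv ℝ (fun y => Θ y ^ 2) x = 0 := fun x hx => fderiv_sq_eq_zero_of_notMem hx
  -- the five integrands and their integrability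
  set P₁ : EuclideanSpace ℝ (Fin 3) → ℝ := fun x => deriv H (F x) * Θ x ^ 2 * (Δ F) x with hP₁
  set P₂ : EuclideanSpace ℝ (Fin 3) → ℝ := fun x => ⟪X x, gradient F x⟫ * (deriv H (F x) * Θ x ^ 2) with hP₂
  set P₃ : EuclideanSpace ℝ (Fin 3) → ℝ := fun x =>
    2 / cylRadius x * (fderiv ℝ F x (eR x) * (deriv H (F x) * Θ x ^ 2)) with hP₃
  set P₄ : EuclideanSpace ℝ (Fin 3) → ℝ := fun x => H (F x) * ⟪X x, gradient (fun y => Θ y ^ 2) x⟫ with hP₄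
  set P₅ : EuclideanSpace ℝ (Fin 3) → ℝ := fun x =>
    2 / cylRadius x * (H (F x) * fderiv ℝ (fun y => Θ y ^ 2) x (eR x)) with hP₅
  have iP₁ : Integrable P₁ :=
    (continuous_integrable_of_continuousOn_of_eq_zero hO hK hΘO
      ((cH'F.mul (cΘ2.continuousOn)).mul cΔF) (fun x hx => by simp [hΘ0 x hx])).2
  have iP₂ : Integrable P₂ :=
    (continuous_integrable_of_continuousOn_of_eq_zero hO hK hΘO
      ((cX.inner cgradF).mul (cH'F.mul cΘ2.continuousOn)) (fun x hx => by simp [hΘ0 x hx])).2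
  have iP₃ : Integrable P₃ :=
    (continuous_integrable_of_continuousOn_of_eq_zero hO hK hΘO
      (cinv.mul ((cfderivF.clm_apply ceR).mul (cH'F.mul cΘ2.continuousOn)))
      (fun x hx => by simp [hΘ0 x hx])).2
  have iP₄ : Integrable P₄ :=
    (continuous_integrable_of_continuousOn_of_eq_zero hO hK hΘO
      (cHF.mul (cX.inner cgradΘ2.continuousOn)) (fun x hx => by
        show H (F x) * ⟪X x, gradient (fun y => Θ y ^ 2) x⟫ = 0
        rw [hgΘ0 x hx, inner_zero_right, mul_zero])).2
  have iP₅ : Integrable P₅ :=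
    (continuous_integrable_of_continuousOn_of_eq_zero hO hK hΘO
      (cinv.mul (cHF.mul (cfderivΘ2.continuousOn.clm_apply ceR))) (fun x hx => by simp [hfΘ0 x hx])).2
  -- (1) the viscous term: Green's identity
  have e₁ : ∫ x, P₁ x = -∫ x, (deriv (deriv H) (F x) * ‖gradient F x‖ ^ 2 * Θ x ^ 2 +
      deriv H (F x) * ⟪gradient F x, gradient (fun y => Θ y ^ 2) x⟫) :=
    integral_laplacian_mul_deriv_comp_mul_sq_of_contDiffOn hO hF2 hH hΘ hΘc hΘO
  -- the test function `ψ = Θ² H(F)` of the two transport terms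
  set ψ : EuclideanSpace ℝ (Fin 3) → ℝ := fun x => Θ x ^ 2 * H (F x) with hψ
  have hψC : ContDiff ℝ 1 ψ :=
    contDiff_cutoff_smul_of_contDiffOn hO hΘ2 (tsupport_mul_subset_right.trans hΘO) (hH1.comp_contDiffOn hF1)
  have hψK : tsupport ψ ⊆ K := tsupport_mul_subset_left.trans tsupport_mul_subset_right
  have hψc : HasCompactSupport ψ := hK.of_isClosed_subset (isClosed_tsupport _) hψK
  have hψO : tsupport ψ ⊆ O := hψK.trans hΘO
  -- `∇ψ = Θ² H'(F) ∇F + H(F) ∇Θ²` everywhere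
  have hgradψ : ∀ x, gradient ψ x =
      (Θ x ^ 2 * deriv H (F x)) • gradient F x + H (F x) • gradient (fun y => Θ y ^ 2) x := by
    intro x
    by_cases hx : x ∈ K
    · have hxO : x ∈ O := hΘO hx
      have hFd : DifferentiableAt ℝ F x := (hF1.differentiableOn one_ne_zero x hxO).differentiableAt (hO.mem_nhds hxO)
      have hHF : DifferentiableAt ℝ (fun y => H (F y)) x :=
        ((hH.differentiable two_ne_zero) (F x)).comp x hFd
      have hΘ2d : DifferentiableAt ℝ (fun y => Θ y ^ 2) x := (hΘ2.differentiable one_ne_zero) x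
      rw [hψ, gradient_mul_apply' hΘ2d hHF,
        gradient_comp_apply ((hH.differentiable two_ne_zero) (F x)) hFd, smul_smul, add_comm]
    · have h0 : gradient ψ x = 0 := gradient_eq_zero_of_notMem_tsupport fun h => hx (hψK h)
      rw [h0, hΘ0 x hx, hgΘ0 x hx]
      simp
  -- (2) the velocity transport term
  have e₂ : ∫ x, P₂ x = -∫ x, P₄ x := by
    have hz := integral_inner_gradient_eq_zero_of_divergence_eq_zero_of_subset hO hX1 hdivX hψC hψc hψO
    have hsplit : ∫ x, ⟪X x, gradient ψ x⟫ = (∫ x, P₂ x) + ∫ x, P₄ x := by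
      rw [← integral_add iP₂ iP₄]
      refine integral_congr_ae (ae_of_all _ fun x => ?_)
      beta_reduce
      rw [hgradψ x]
      simp only [hP₂, hP₄, inner_add_right, inner_smul_right]
      ring
    rw [hsplit] at hz
    linarith
  -- (3) the drift term, `b = (2/ϱ) e_ϱ`
  have e₃ : ∫ x, P₃ x = -∫ x, P₅ x := by
    have hb1 : ContDiffOn ℝ 1 (fun y : EuclideanSpace ℝ (Fin 3) => (2 / cylRadius y) • eR y) O :=
      fun x hx => (contDiffAt_axisDrift (hOρ x hx)).contDiffWithinAt
    have hbdiv : ∀ x ∈ O, VectorCalculus.divergence (fun y : EuclideanSpace ℝ (Fin 3) => (2 / cylRadius y) • eR y) x = 0 :=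
      fun x hx => divergence_axisDrift_eq_zero (hOρ x hx)
    have hz := integral_inner_gradient_eq_zero_of_divergence_eq_zero_of_subset hO hb1 hbdiv hψC hψc hψO
    have hsplit : ∫ x, ⟪(2 / cylRadius x) • eR x, gradient ψ x⟫ = (∫ x, P₃ x) + ∫ x, P₅ x := by
      rw [← integral_add iP₃ iP₅]
      refine integral_congr_ae (ae_of_all _ fun x => ?_)
      beta_reduce
      rw [hgradψ x]
      simp only [hP₃, hP₅, inner_add_right, inner_smul_right, inner_axisDrift_gradient]
      ring
    rw [hsplit] at hz
    linarith
  -- the left-hand side is `∫ (P₁ - P₂ - P₃)`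
  have eL : ∫ x, deriv H (F x) * ((Δ F) x - fderiv ℝ F x (X x) -
      2 / cylRadius x * partialDeriv (eR x) F x) * Θ x ^ 2 = ((∫ x, P₁ x) - ∫ x, P₂ x) - ∫ x, P₃ x := by
    calc ∫ x, deriv H (F x) * ((Δ F) x - fderiv ℝ F x (X x) -
          2 / cylRadius x * partialDeriv (eR x) F x) * Θ x ^ 2 = ∫ x, ((P₁ x - P₂ x) - P₃ x) := by
          refine integral_congr_ae (ae_of_all _ fun x => ?_)
          beta_reduce
          simp only [hP₁, hP₂, hP₃, partialDeriv_apply]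
          rw [real_inner_comm (gradient F x) (X x), inner_gradient_left]
          ring
      _ = (∫ x, (P₁ x - P₂ x)) - ∫ x, P₃ x := integral_sub (iP₁.sub iP₂) iP₃
      _ = ((∫ x, P₁ x) - ∫ x, P₂ x) - ∫ x, P₃ x := by rw [integral_sub iP₁ iP₂]
  rw [eL, e₁, e₂, e₃]
  ring

/-! ### Continuity in time of the slice functionals -/

/-- **Continuity in time of the slice functionals of the energy method** on a slab `]lo, hi[ × O`
(`O` open, off the axis) for a function `Φ` continuous on the slab with `C¹` slices and jointly
continuous gradient and time derivative, a jointly continuous drift `U`, `H ∈ C²`, `Θ ∈ C¹_c` with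
`tsupport Θ ⊆ O`: the seven functionals `M = ∫H(Φ)Θ²`, `G_H = ∫H''(Φ)|∇Φ|²Θ²`,
`T₁ = ∫H'(Φ)⟪∇Φ, ∇Θ²⟫`, `P = ∫H(Φ)|∇Θ|²`, `T_U = ∫H(Φ)⟪U, ∇Θ²⟫`, `T_b = ∫(2/ϱ)H(Φ)∂_ϱ(Θ²)` and
`D = ∫H'(Φ)(∂ₜΦ)Θ²` are continuous on `]lo, hi[` (parametric integrals of jointly continuous
integrands vanishing off the compact `tsupport Θ`). [folklore] -/
theorem continuousOn_drift_sliceFunctionals : ∀ (O : Set (EuclideanSpace ℝ (Fin 3))), IsOpen O →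
    (∀ x ∈ O, cylRadius x ≠ 0) → ∀ (lo hi : ℝ)
    (Φ : ℝ → EuclideanSpace ℝ (Fin 3) → ℝ) (U : ℝ → EuclideanSpace ℝ (Fin 3) → EuclideanSpace ℝ (Fin 3)),
    ContinuousOn (uncurry Φ) (Ioo lo hi ×ˢ O) →
    ContinuousOn (fun z : ℝ × EuclideanSpace ℝ (Fin 3) => fderiv ℝ (Φ z.1) z.2) (Ioo lo hi ×ˢ O) →
    ContinuousOn (fun z : ℝ × EuclideanSpace ℝ (Fin 3) => deriv (fun r => Φ r z.2) z.1) (Ioo lo hi ×ˢ O) →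
    ContinuousOn (uncurry U) (Ioo lo hi ×ˢ O) →
    ∀ (H : ℝ → ℝ), ContDiff ℝ 2 H →
    ∀ (Θ : EuclideanSpace ℝ (Fin 3) → ℝ), ContDiff ℝ 1 Θ → HasCompactSupport Θ → tsupport Θ ⊆ O →
    ∀ (M GH T₁ Pf TU Tb D : ℝ → ℝ),
    (∀ s, M s = ∫ x, H (Φ s x) * Θ x ^ 2) →
    (∀ s, GH s = ∫ x, deriv (deriv H) (Φ s x) * ‖gradient (Φ s) x‖ ^ 2 * Θ x ^ 2) →
    (∀ s, T₁ s = ∫ x, deriv H (Φ s x) * inner ℝ (gradient (Φ s) x) (gradient (fun y => Θ y ^ 2) x)) →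
    (∀ s, Pf s = ∫ x, H (Φ s x) * ‖gradient Θ x‖ ^ 2) →
    (∀ s, TU s = ∫ x, H (Φ s x) * inner ℝ (U s x) (gradient (fun y => Θ y ^ 2) x)) →
    (∀ s, Tb s = ∫ x, 2 / cylRadius x * (H (Φ s x) * fderiv ℝ (fun y => Θ y ^ 2) x (eR x))) →
    (∀ s, D s = ∫ x, deriv H (Φ s x) * deriv (fun r => Φ r x) s * Θ x ^ 2) →
    ContinuousOn M (Ioo lo hi) ∧ ContinuousOn GH (Ioo lo hi) ∧ ContinuousOn T₁ (Ioo lo hi) ∧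
      ContinuousOn Pf (Ioo lo hi) ∧ ContinuousOn TU (Ioo lo hi) ∧ ContinuousOn Tb (Ioo lo hi) ∧
      ContinuousOn D (Ioo lo hi) := by
  intro O hO hOρ lo hi Φ U hΦc hΦg hΦt' hUc H hH Θ hΘ hΘc hΘO M GH T₁ Pf TU Tb D hM hGH hT₁ hPf hTU hTb hD
  -- adapted from `Literature.Analysis.FluidPDE.Seregin2020.continuousOn_swirl_sliceFunctionals`
  set K : Set (EuclideanSpace ℝ (Fin 3)) := tsupport Θ with hKdef
  have hK : IsCompact K := hΘc
  have hΘ0 : ∀ x, x ∉ K → Θ x = 0 := fun x hx => image_eq_zero_of_notMem_tsupport hx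
  have hgΘ0 : ∀ x, x ∉ K → gradient (fun y => Θ y ^ 2) x = 0 := fun x hx => gradient_sq_eq_zero_of_notMem hx
  have hfΘ0 : ∀ x, x ∉ K → fderiv ℝ (fun y => Θ y ^ 2) x = 0 := fun x hx => fderiv_sq_eq_zero_of_notMem hx
  have hgΘ0' : ∀ x, x ∉ K → gradient Θ x = 0 := fun x hx => gradient_eq_zero_of_notMem_tsupport hx
  have hρS : ∀ z ∈ Ioo lo hi ×ˢ O, cylRadius z.2 ≠ 0 := fun z hz => hOρ z.2 hz.2
  have hH' : ContDiff ℝ 1 (deriv H) := by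
    have h2' : ContDiff ℝ (1 + 1) H := by rw [one_add_one_eq_two]; exact hH
    exact h2'.deriv'
  have hΘ2 : ContDiff ℝ 1 fun y => Θ y ^ 2 := hΘ.pow 2
  -- continuity on the slab of the building blocks (as space–time functions)
  have cΦ : ContinuousOn (fun z : ℝ × EuclideanSpace ℝ (Fin 3) => Φ z.1 z.2) (Ioo lo hi ×ˢ O) := hΦc
  have cHΦ : ContinuousOn (fun z : ℝ × EuclideanSpace ℝ (Fin 3) => H (Φ z.1 z.2)) (Ioo lo hi ×ˢ O) :=
    hH.continuous.comp_continuousOn cΦ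
  have cH'Φ : ContinuousOn (fun z : ℝ × EuclideanSpace ℝ (Fin 3) => deriv H (Φ z.1 z.2)) (Ioo lo hi ×ˢ O) :=
    hH'.continuous.comp_continuousOn cΦ
  have cH''Φ : ContinuousOn (fun z : ℝ × EuclideanSpace ℝ (Fin 3) => deriv (deriv H) (Φ z.1 z.2)) (Ioo lo hi ×ˢ O) :=
    (hH'.continuous_deriv le_rfl).comp_continuousOn cΦ
  have cgΦ : ContinuousOn (fun z : ℝ × EuclideanSpace ℝ (Fin 3) => gradient (Φ z.1) z.2) (Ioo lo hi ×ˢ O) :=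
    (InnerProductSpace.toDual ℝ (EuclideanSpace ℝ (Fin 3))).symm.continuous.comp_continuousOn hΦg
  have cU : ContinuousOn (fun z : ℝ × EuclideanSpace ℝ (Fin 3) => U z.1 z.2) (Ioo lo hi ×ˢ O) := hUc
  have cΘ2 : Continuous fun z : ℝ × EuclideanSpace ℝ (Fin 3) => Θ z.2 ^ 2 := (hΘ.continuous.comp continuous_snd).pow 2
  have cgΘ : Continuous fun z : ℝ × EuclideanSpace ℝ (Fin 3) => gradient Θ z.2 :=
    (continuous_gradient_of_contDiff hΘ).comp continuous_snd
  have cgΘ2 : Continuous fun z : ℝ × EuclideanSpace ℝ (Fin 3) => gradient (fun y => Θ y ^ 2) z.2 :=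
    (continuous_gradient_of_contDiff hΘ2).comp continuous_snd
  have cfΘ2 : Continuous fun z : ℝ × EuclideanSpace ℝ (Fin 3) => fderiv ℝ (fun y => Θ y ^ 2) z.2 :=
    (hΘ2.continuous_fderiv one_ne_zero).comp continuous_snd
  have ceR : ContinuousOn (fun z : ℝ × EuclideanSpace ℝ (Fin 3) => eR z.2) (Ioo lo hi ×ˢ O) :=
    continuousOn_eR_offAxis.comp continuous_snd.continuousOn fun z hz => hρS z hz
  have cinv : ContinuousOn (fun z : ℝ × EuclideanSpace ℝ (Fin 3) => 2 / cylRadius z.2) (Ioo lo hi ×ˢ O) :=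
    continuousOn_const.div (continuous_cylRadius.comp continuous_snd).continuousOn hρS
  -- the seven functionals
  refine ⟨?_, ?_, ?_, ?_, ?_, ?_, ?_⟩
  · have h := continuousOn_integral_slice_of_eq_zero (I := Ioo lo hi) hO hK hΘO
      (Φ := fun z : ℝ × EuclideanSpace ℝ (Fin 3) => H (Φ z.1 z.2) * Θ z.2 ^ 2)
      (cHΦ.mul cΘ2.continuousOn) (fun s x hx => by simp [hΘ0 x hx])
    exact h.congr fun s _ => hM s
  · have h := continuousOn_integral_slice_of_eq_zero (I := Ioo lo hi) hO hK hΘO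
      (Φ := fun z : ℝ × EuclideanSpace ℝ (Fin 3) =>
        deriv (deriv H) (Φ z.1 z.2) * ‖gradient (Φ z.1) z.2‖ ^ 2 * Θ z.2 ^ 2)
      ((cH''Φ.mul (cgΦ.norm.pow 2)).mul cΘ2.continuousOn) (fun s x hx => by simp [hΘ0 x hx])
    exact h.congr fun s _ => hGH s
  · have h := continuousOn_integral_slice_of_eq_zero (I := Ioo lo hi) hO hK hΘO
      (Φ := fun z : ℝ × EuclideanSpace ℝ (Fin 3) =>
        deriv H (Φ z.1 z.2) * ⟪gradient (Φ z.1) z.2, gradient (fun y => Θ y ^ 2) z.2⟫)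
      (cH'Φ.mul (cgΦ.inner cgΘ2.continuousOn)) (fun s x hx => by
        show deriv H (Φ s x) * ⟪gradient (Φ s) x, gradient (fun y => Θ y ^ 2) x⟫ = 0
        rw [hgΘ0 x hx, inner_zero_right, mul_zero])
    exact h.congr fun s _ => hT₁ s
  · have h := continuousOn_integral_slice_of_eq_zero (I := Ioo lo hi) hO hK hΘO
      (Φ := fun z : ℝ × EuclideanSpace ℝ (Fin 3) => H (Φ z.1 z.2) * ‖gradient Θ z.2‖ ^ 2)
      (cHΦ.mul (cgΘ.norm.pow 2).continuousOn) (fun s x hx => by simp [hgΘ0' x hx])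
    exact h.congr fun s _ => hPf s
  · have h := continuousOn_integral_slice_of_eq_zero (I := Ioo lo hi) hO hK hΘO
      (Φ := fun z : ℝ × EuclideanSpace ℝ (Fin 3) => H (Φ z.1 z.2) * ⟪U z.1 z.2, gradient (fun y => Θ y ^ 2) z.2⟫)
      (cHΦ.mul (cU.inner cgΘ2.continuousOn)) (fun s x hx => by
        show H (Φ s x) * ⟪U s x, gradient (fun y => Θ y ^ 2) x⟫ = 0
        rw [hgΘ0 x hx, inner_zero_right, mul_zero])
    exact h.congr fun s _ => hTU s
  · have h := continuousOn_integral_slice_of_eq_zero (I := Ioo lo hi) hO hK hΘO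
      (Φ := fun z : ℝ × EuclideanSpace ℝ (Fin 3) =>
        2 / cylRadius z.2 * (H (Φ z.1 z.2) * fderiv ℝ (fun y => Θ y ^ 2) z.2 (eR z.2)))
      (cinv.mul (cHΦ.mul (cfΘ2.continuousOn.clm_apply ceR))) (fun s x hx => by simp [hfΘ0 x hx])
    exact h.congr fun s _ => hTb s
  · have h := continuousOn_integral_slice_of_eq_zero (I := Ioo lo hi) hO hK hΘO
      (Φ := fun z : ℝ × EuclideanSpace ℝ (Fin 3) =>
        deriv H (Φ z.1 z.2) * deriv (fun r => Φ r z.2) z.1 * Θ z.2 ^ 2)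
      ((cH'Φ.mul hΦt').mul cΘ2.continuousOn) (fun s x hx => by simp [hΘ0 x hx])
    exact h.congr fun s _ => hD s

end Summit.NavierStokesRegularity.NavierStokesRegularity.Theorems.AxisymmetricKatoGlobal.EulerScaling

end
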